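import Literature.Analysis.FluidPDE.KNSSMildCompactness
import Literature.Analysis.FluidPDE.KNSSRemark61
import HarnessLib

/-!
# The Oseen identity passes to pointwise limits; a KNSS blow-up limit with constant slices is ONE
# unit vector (KNSS 2009, Lemma 6.1 + Remark 6.1 — proved)

Analysis/FluidPDE support file (everything proved, no definitions), continuing
`KNSSMildCompactness` (KNSS 2009 Lemma 6.1 rate-free: `KNSS2009_lemma61_of_oseenMild`, whose
conclusion CARRIES the Oseen integral identity of the limit, and the extraction theorems
`isKNSSBlowupLimit_of_oseenMild_zoom{,_vertex,_nearVertex}`, whose conclusions DROP it — they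
return `IsKNSSBlowupLimit W` and the slice-wise locally uniform convergence only). Downstream users
(the zone-Z1 dictionary `Summits/NavierStokesRegularity/OSWSelfSimilar/TypeIIInnerLimit*`) need the
identity back on the limit they were handed, to apply

> **Remark 6.1** (Koch–Nadirashvili–Seregin–Šverák, Acta Math. 203 (2009) = arXiv:0709.3599,
> p. 11; tree `KNSS2009_remark61`, proved in `KNSSRemark61`): a bounded ancient mild solution of
> the form `u(x, t) = b(t)` is constant.

This file proves, separately from any extraction:

* `oseenIdentity_of_tendsto_oseenMild` — **the Oseen identity passes to the limit** (the last step
  of the printed proof of Lemma 6.1, "The fact that `v` is a mild solution … follows from standard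
  limit procedures", isolated): if classical Oseen-mild solutions `w⁽ᵏ⁾` on `(A_k, B_k)`,
  `A_k → −∞`, `B_k > 0`, uniformly bounded by `N` on `(A_k, 0)`, converge POINTWISE at every
  negative time to a `W` jointly continuous on `(−∞, 0) × ℝ³`, then `W` satisfies the Oseen
  integral identity `W(t) = e^{(t−s)Δ}W(s) − B¹_s(W, W)(t)` between all `s < t < 0` (dominated
  convergence in both terms, tree `tendsto_heatExtension_of_tendsto_of_bound` /
  `tendsto_oseenDuhamel_of_tendsto_of_bound`);
* `oseenIdentity_of_tendstoLocallyUniformly_subseq` — the same along a subsequence with slice-wise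
  locally uniform convergence (the output shape of the extraction theorems);
* `eq_of_oseenIdentity_of_slice_const` — **Remark 6.1 for such limits**: a field with the Oseen
  identity whose negative slices are constant in space is ONE constant on `(−∞, 0) × ℝ³`;
* `IsKNSSBlowupLimit.norm_eq_one_of_const` — a KNSS blow-up limit (`|W| ≤ 1 = sup|W|`) which is
  one constant `c` has `‖c‖ = 1`: the degenerate inner object of a blow-up zoom is a UNIT uniform
  stream.

## References

* G. Koch, N. Nadirashvili, G. Seregin, V. Šverák, *Liouville theorems for the Navier–Stokes
  equations and applications*, Acta Math. 203 (2009) 83–105 = arXiv:0709.3599: Lemma 6.1 and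
  Remark 6.1 (p. 11), §4 (i) (p. 8). [KochNadirashviliSereginSverak2009]
-/

noncomputable section

open MeasureTheory Set Function Filter TopologicalSpace Metric
open _root_.Topology
open scoped RealInnerProductSpace NNReal ENNReal

namespace Literature.Analysis.FluidPDE

/-- **The Oseen integral identity passes to pointwise limits of uniformly bounded Oseen-mild
solutions** (KNSS 2009, proof of Lemma 6.1, arXiv p. 11: "The fact that `v` is a mild solution in
`ℝ³ × (−∞, 0)` follows from standard limit procedures"; the tree's `KNSS2009_lemma61_of_oseenMild`
performs this step internally for the subsequence it extracts — here it is stated for ANY pointwise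
limit). Let `w⁽ᵏ⁾` be classical solutions (`ν = 1`, unforced) on `ℝ³ × (A_k, B_k)`, `A_k → −∞`,
`B_k > 0`, satisfying the Oseen identity between all times of their windows, with
`‖w⁽ᵏ⁾(τ, x)‖ ≤ N` for `A_k < τ < 0`; let `W` be jointly continuous on `(−∞, 0) × ℝ³` with
`w⁽ᵏ⁾(t, x) → W(t, x)` for every `t < 0`, `x`. Then for all `s < t < 0` and `x`,
`W(t, x) = e^{(t−s)Δ}W(s)(x) − B¹_s(W, W)(t)(x)`. [cite: KochNadirashviliSereginSverak2009, Lemma 6.1 (arXiv p. 11)] -/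
theorem oseenIdentity_of_tendsto_oseenMild {N : ℝ} (hN : 0 ≤ N) {A B : ℕ → ℝ}
    {w : ℕ → ℝ → EuclideanSpace ℝ (Fin 3) → EuclideanSpace ℝ (Fin 3)}
    {q : ℕ → ℝ → EuclideanSpace ℝ (Fin 3) → ℝ}
    (hAlim : Tendsto A atTop atBot) (hBpos : ∀ k, 0 < B k)
    (hw : ∀ k, IsClassicalNSSolutionOn (Ioo (A k) (B k)) 1 0 (w k) (q k))
    (hmildAB : ∀ k, ∀ s t : ℝ, A k < s → s < t → t < B k → ∀ x,
      w k t x = UnboundedOperators.heatExtension (w k s) (t - s) x - oseenDuhamel 1 s (w k) (w k) t x)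
    (hbd : ∀ k, ∀ τ ∈ Ioo (A k) 0, ∀ x, ‖w k τ x‖ ≤ N)
    {W : ℝ → EuclideanSpace ℝ (Fin 3) → EuclideanSpace ℝ (Fin 3)}
    (hWc : ContinuousOn (uncurry W) (Iio 0 ×ˢ univ))
    (hpt : ∀ t < 0, ∀ x, Tendsto (fun k => w k t x) atTop (𝓝 (W t x))) :
    ∀ s t : ℝ, s < t → t < 0 → ∀ x,
      W t x = UnboundedOperators.heatExtension (W s) (t - s) x - oseenDuhamel 1 s W W t x := by
  have hcont : ∀ k, ContinuousOn (uncurry (w k)) (Ioo (A k) (B k) ×ˢ univ) := fun k =>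
    (hw k).smooth_velocity.continuousOn
  have hslice : ∀ k, ∀ t ∈ Ioo (A k) (B k), Continuous (w k t) := fun k t ht =>
    (hcont k).comp_continuous (Continuous.prodMk_right t) fun x => ⟨ht, mem_univ x⟩
  have hdom : ∀ t : ℝ, ∀ᶠ j in atTop, A j < t := fun t => hAlim.eventually (eventually_lt_atBot t)
  intro s t hst ht x
  have hs0 : s < 0 := hst.trans ht
  obtain ⟨k₀, hk₀⟩ := eventually_atTop.1 (hdom s)
  -- shift the sequence so that every window contains `[s, t]`
  set u : ℕ → ℝ → (EuclideanSpace ℝ (Fin 3)) → (EuclideanSpace ℝ (Fin 3)) :=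
    fun j => w (j + k₀) with hu
  have hAu : ∀ j, A (j + k₀) < s := fun j => hk₀ _ (Nat.le_add_left _ _)
  have hshift : Tendsto (fun j => j + k₀) atTop atTop := tendsto_add_atTop_nat k₀
  have huM : ∀ j, ∀ τ ∈ Ioo s t, ∀ y, ‖u j τ y‖ ≤ N := fun j τ hτ y =>
    hbd _ τ ⟨(hAu j).trans hτ.1, hτ.2.trans ht⟩ y
  have hum : ∀ j, AEStronglyMeasurable (uncurry (u j))
      ((volume : Measure (ℝ × (EuclideanSpace ℝ (Fin 3)))).restrict (Ioo s t ×ˢ univ)) :=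
    fun j => ((hcont _).mono (prod_mono
      (fun τ hτ => ⟨(hAu j).trans hτ.1, (hτ.2.trans ht).trans (hBpos _)⟩)
        Subset.rfl)).aestronglyMeasurable (measurableSet_Ioo.prod MeasurableSet.univ)
  have hWm : AEStronglyMeasurable (uncurry W)
      ((volume : Measure (ℝ × (EuclideanSpace ℝ (Fin 3)))).restrict (Ioo s t ×ˢ univ)) :=
    (hWc.mono (prod_mono (fun τ hτ => hτ.2.trans ht) Subset.rfl)).aestronglyMeasurable
      (measurableSet_Ioo.prod MeasurableSet.univ)
  have hptu : ∀ τ < 0, ∀ y, Tendsto (fun j => u j τ y) atTop (𝓝 (W τ y)) := fun τ hτ y =>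
    (hpt τ hτ y).comp hshift
  have hD : Tendsto (fun j => oseenDuhamel 1 s (u j) (u j) t x) atTop
      (𝓝 (oseenDuhamel 1 s W W t x)) :=
    tendsto_oseenDuhamel_of_tendsto_of_bound one_pos hN hst hum hWm huM
      (fun τ hτ y => hptu τ (hτ.2.trans ht) y) x
  have hH : Tendsto (fun j => UnboundedOperators.heatExtension (u j s) (t - s) x) atTop
      (𝓝 (UnboundedOperators.heatExtension (W s) (t - s) x)) :=
    tendsto_heatExtension_of_tendsto_of_bound (M := N)
      (fun j => (hslice _ s ⟨hAu j, hs0.trans (hBpos _)⟩).aestronglyMeasurable)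
      (fun j z => hbd _ s ⟨hAu j, hs0⟩ z) (hptu s hs0) (sub_pos.2 hst) x
  have hid : (fun j => u j t x) = fun j =>
      UnboundedOperators.heatExtension (u j s) (t - s) x - oseenDuhamel 1 s (u j) (u j) t x :=
    funext fun j => hmildAB _ s t (hAu j) hst (ht.trans (hBpos _)) x
  have hlim2 : Tendsto (fun j => u j t x) atTop
      (𝓝 (UnboundedOperators.heatExtension (W s) (t - s) x - oseenDuhamel 1 s W W t x)) := by
    rw [hid]; exact hH.sub hD
  exact tendsto_nhds_unique (hptu t ht x) hlim2

/-- **The Oseen identity along an extracted subsequence** (the output shape of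
`isKNSSBlowupLimit_of_oseenMild_zoom{,_vertex,_nearVertex}` and of `KNSS2009_lemma61_of_oseenMild`):
under the hypotheses of `oseenIdentity_of_tendsto_oseenMild` on the family `w⁽ᵏ⁾`, if
`w⁽ᵠ⁽ᵏ⁾⁾(t) → W(t)` LOCALLY UNIFORMLY for every `t < 0` along a strictly increasing `φ`, and `W` is
jointly continuous on `(−∞, 0) × ℝ³`, then `W` satisfies the Oseen identity between all
`s < t < 0`. [cite: KochNadirashviliSereginSverak2009, Lemma 6.1 (arXiv p. 11)] -/
theorem oseenIdentity_of_tendstoLocallyUniformly_subseq {N : ℝ} (hN : 0 ≤ N) {A B : ℕ → ℝ}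
    {w : ℕ → ℝ → EuclideanSpace ℝ (Fin 3) → EuclideanSpace ℝ (Fin 3)}
    {q : ℕ → ℝ → EuclideanSpace ℝ (Fin 3) → ℝ}
    (hAlim : Tendsto A atTop atBot) (hBpos : ∀ k, 0 < B k)
    (hw : ∀ k, IsClassicalNSSolutionOn (Ioo (A k) (B k)) 1 0 (w k) (q k))
    (hmildAB : ∀ k, ∀ s t : ℝ, A k < s → s < t → t < B k → ∀ x,
      w k t x = UnboundedOperators.heatExtension (w k s) (t - s) x - oseenDuhamel 1 s (w k) (w k) t x)
    (hbd : ∀ k, ∀ τ ∈ Ioo (A k) 0, ∀ x, ‖w k τ x‖ ≤ N)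
    {φ : ℕ → ℕ} (hφ : StrictMono φ)
    {W : ℝ → EuclideanSpace ℝ (Fin 3) → EuclideanSpace ℝ (Fin 3)}
    (hWc : ContinuousOn (uncurry W) (Iio 0 ×ˢ univ))
    (hconv : ∀ t < 0, TendstoLocallyUniformly (fun k => w (φ k) t) (W t) atTop) :
    ∀ s t : ℝ, s < t → t < 0 → ∀ x,
      W t x = UnboundedOperators.heatExtension (W s) (t - s) x - oseenDuhamel 1 s W W t x :=
  oseenIdentity_of_tendsto_oseenMild (A := A ∘ φ) (B := B ∘ φ) (w := fun k => w (φ k))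
    (q := fun k => q (φ k)) hN (hAlim.comp hφ.tendsto_atTop) (fun k => hBpos (φ k))
    (fun k => hw (φ k)) (fun k => hmildAB (φ k)) (fun k => hbd (φ k)) hWc
    fun t ht x => ((hconv t ht).tendstoLocallyUniformlyOn (s := univ)).tendsto_at (mem_univ x)

/-- **KNSS 2009, Remark 6.1, for fields with the Oseen identity whose slices are constant in
space** (arXiv:0709.3599, p. 11; tree `KNSS2009_remark61`): if `W` satisfies the Oseen identity
(`ν = 1`) between all `s < t < 0` and `W(s, y) = W(s, 0)` for every `s < 0`, `y`, then `W` is ONE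
constant on `(−∞, 0) × ℝ³`: `W(s, y) = W(t, 0)` for all `s, t < 0`. [cite: KochNadirashviliSereginSverak2009, Remark 6.1 (arXiv p. 11)] -/
theorem eq_of_oseenIdentity_of_slice_const
    {W : ℝ → EuclideanSpace ℝ (Fin 3) → EuclideanSpace ℝ (Fin 3)}
    (hmild : ∀ s t : ℝ, s < t → t < 0 → ∀ x,
      W t x = UnboundedOperators.heatExtension (W s) (t - s) x - oseenDuhamel 1 s W W t x)
    (hc : ∀ s < 0, ∀ y : EuclideanSpace ℝ (Fin 3), W s y = W s 0) :
    ∀ s < 0, ∀ t < 0, ∀ y : EuclideanSpace ℝ (Fin 3), W s y = W t 0 := by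
  have hrem := KNSS2009_remark61 (E := EuclideanSpace ℝ (Fin 3)) one_pos (u := W)
    (b := fun t => W t 0) hc fun s t hst ht => Eventually.of_forall fun x => by
      rw [one_mul]; exact hmild s t hst ht x
  intro s hs t ht y
  rw [hc s hs y]
  exact hrem s t hs ht

/-- **The degenerate inner object is a UNIT uniform stream**: a KNSS blow-up limit
(`IsKNSSBlowupLimit`: `|W| ≤ 1` on `(−∞, 0) × ℝ³` and values above `1 − ε` for every `ε > 0`)
which is one constant `c` on `(−∞, 0) × ℝ³` has `‖c‖ = 1`. [cite: KochNadirashviliSereginSverak2009, Prop 6.1 and (6.3) (arXiv p. 11)] -/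
theorem IsKNSSBlowupLimit.norm_eq_one_of_const
    {W : ℝ → EuclideanSpace ℝ (Fin 3) → EuclideanSpace ℝ (Fin 3)} (hW : IsKNSSBlowupLimit W)
    {c : EuclideanSpace ℝ (Fin 3)} (hc : ∀ s < 0, ∀ y, W s y = c) : ‖c‖ = 1 := by
  refine le_antisymm ?_ (le_of_forall_pos_lt_add fun ε hε => ?_)
  · have h := hW.norm_le_one (-1) (by norm_num) 0
    rwa [hc (-1) (by norm_num) 0] at h
  · obtain ⟨s, hs, y, hy⟩ := hW.exists_lt_norm ε hε
    rw [hc s hs y] at hy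
    linarith

end Literature.Analysis.FluidPDE

end
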